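/-
Copyright (c) 2026 the pub-hodgecm-mathlib formalisation cell (harness21).  Prover seat hodgecm-mathlib-B-p04 (g35), heir of the (R2) EP pen — (S8b) «(N)-ram
assembly», the CM face of ★ (S8a), after A-p06 (g27)'s recipe 2026-09-01T10:08Z∕10:13Z; the `hNtame` binder of B-p14 (g32)'s ★ «EP-RAM-FOLD» p843559.
-/
import Literature.NumberTheory.Rogawski1990.RankOneEulerPoincareNonsplitRamifiedPackage    -- ★ B-p14 (g32) p843499: the levels `K♯_D`, `K`, `K♯_D ⊓ K`; compact ∕ open; `mem_comap_map_conj_glInt_iff`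
import Literature.NumberTheory.Automorphic.HermitianLatticeTreePeriodDictionary           -- ★ B-p04 (g35) (S8a): `natCard_quotient_fixedBy_add_eq_natCard_quotient_fixedBy_inf`
import Literature.NumberTheory.Automorphic.HermitianLatticeTreeTransitiveRamifiedFlags   -- ★ A-p06 (g27) p843469: ramified (hA)(hB)(hI)
import Literature.NumberTheory.Automorphic.OrbitalIntegralFixedPointsPerPeriodTorus      -- ★ A-p06 (g27) p843359: `Φ(⟦γ⟧, 𝟙_C) = ν(C)·#(Fix∕τ^ℤ)`
import Literature.NumberTheory.Automorphic.UnitaryGroupSplitTorusRankOne                 -- ★ A-p06 (g27) p843441: the split-torus generator `τ`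
import Literature.NumberTheory.Automorphic.RegularDiagonalNoFixedCosets                  -- ★ F0P3a-p04 (g13) p843468: no fixed cosets off the compact torus
import Literature.NumberTheory.Automorphic.OrbitalMeasureCanonicalExistsCM               -- ★ `compactCore_centralizer_local_facts_of_isRegularElt`
import Literature.NumberTheory.Automorphic.UnitaryRankTwoRegularTorusTrichotomy          -- ★ B-p14 `exists_conj_val_eq_glDiagonal_of_not_compactSpace_centralizer`
import Literature.NumberTheory.Automorphic.UnitaryTwoEulerPoincareEllipticInert            -- ★ B-p08 (g28): base-edge lemmas, `isModularLattice_latt_glDiagonal_one`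
import Literature.NumberTheory.Automorphic.UnitaryUnitOrbitalIntegralFixedPoints          -- ★ `isClosed_conjClass_local_of_isRegularElt`, `isRegularElt_val_conj`
import HarnessLib

/-!
# Kottwitz's NON-ELLIPTIC relation (N) on `U(Φ₂)(L⁺_v)` at a TAMELY RAMIFIED non-split place, from the tree per period of the split torus

Topic `NumberTheory/Rogawski1990`; namespace `Literature.NumberTheory.Rogawski1990`.  THEOREMS ONLY (no definition, no instance, no notation, no named fact, no
`sorry`); kernel lane.  Cell `pub/hodgecm-mathlib` (D-0151), crux H413 = `stmt-HodgeConjecture-24833`, line «N6nsGerm», stub `stub_N6nsR2EP :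
RankOneEulerPoincareNonsplit` [Kottwitz1988 §2 Thm 2], RAMIFIED half, brick (S8) of A-p06 (g27)'s census (assembled by the EP pen after his recipe): the
`hNtame` binder of ★ B-p14 (g32) `rankOneEulerPoincareNonsplit_of_tameNonElliptic_of_wildRamified`.  HONEST LABEL: HC_CM is proved only modulo the cell's
remaining named inputs (hLiu418, h413) until rung 0 closes; after this file `RankOneEulerPoincareNonsplit` is a tree theorem modulo the WILD ramified residue
(`v ∣ 2` ramified) alone.

THE MATHEMATICS.  `v` tamely ramified non-split, `w ∣ v`, `η` a uniformiser of `L_w`, `U₂ = U(Φ₂)(L⁺_v)`, levels `K♯ = K♯_{D_η}` (vertex stabiliser,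
`D_η = diag(1, η)`), `K = U(Φ₂)(𝒪_v)` (edge-midpoint stabiliser), `I = K♯ ⊓ K`.  For `γ ∈ U₂` regular with NON-compact centraliser: `γ` is conjugate to `δ` with
`e_w δ = diag(d)`, `d₀ ≠ d₁` (★ B-p14); `Z(δ)` is commutative with compact open compact core (★ A-p03∕A-p06) and `τ := e_w⁻¹ diag(η, (σ_w η)⁻¹) ∈ Z(δ)` generates it
modulo the compact core (★ A-p06 p843441), so `ν(C)⁻¹ Φ(⟦δ⟧, 𝟙_C) = #(Fix_δ(U₂⧸C)∕τ^ℤ)` for every compact open `C` (★ A-p06 p843359).  If `|d₀| ≠ 1` all three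
fixed sets are empty (★ F0P3a-p04 p843468) and (N) reads `0 + 0 − 0 = 0`; if `|d₀| = 1` (so `|d₁| = 1` by unitarity) the three per-period counts are the
per-period counts of `δ_w`-fixed self-dual vertices, `η`-modular vertices and flags of the lattice tree (★ B-p04 (S8a) over ★ A-p17 (S6)), and «fixed vertices =
fixed edges per period» (★ A-p06 (S7b) p843537) gives `#K-term + #K♯-term = #I-term`, i.e. (N).

* §0 `epCombination_eq_zero_of_natCard_quotient_add_eq` (generic `G`) — the three-term combination vanishes once the per-period counts add up.
* §1 `epNonEllipticRelation_vertexEdgeLevels_of_diagonal_of_ramified` — (N) at a class with a REGULAR DIAGONAL one-place image.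
ELABORATION NOTE (for the next hand on this carrier).  §1 runs under `maxHeartbeats 1000000` (measured need: > 400000): every generic lemma instantiated at
`G := (cmDatum L 2 Φ₂).Local v` pays for unfolding `cmDatum` to reconcile its instances with those of `↥(«local» …)`; and the model `eU : U₂ ≃* U(σ_w, antidiag(1,1))`
is kept behind the generic ★ `MulEquiv.subgroupCongr_apply` (`heU`) — letting the kernel compare `placeForm Φ₂ w` with `!![0,1;1,0]` definitionally through the
coercions of `eU` does not terminate in practice (kernel timeout at 10⁶ heartbeats).
* §2 **`epNonEllipticRelation_vertexEdgeLevels_of_ramified`** — (N) for every regular non-elliptic `γ`: the `hNtame` binder of ★ «EP-RAM-FOLD» (per place).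

## References
* [Kottwitz1988] R. E. Kottwitz, *Tamagawa numbers*, Ann. of Math. 127 (1988), 629–646, §2 Theorem 2.
* [Serre1980Trees] J.-P. Serre, *Trees* (1980), Ch. I §6.4, Ch. II §1.1–§1.3 (hyperbolic elements act on the tree by translations along an apartment).
* [Laumon1995] G. Laumon, *Cohomology of Drinfeld Modular Varieties* I (1996), Lemma (5.3.2).
* [Rogawski1990] J. D. Rogawski, *Automorphic Representations of Unitary Groups in Three Variables* (1990), §12.6 p. 174; §4.9 (4.9.2) p. 55; §3.6 pp. 31–32.
-/

set_option autoImplicit false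

noncomputable section

open scoped ValuativeRel Matrix MatrixGroups
open Matrix ValuativeRel NumberField IsDedekindDomain MulAction MeasureTheory Measure

namespace Literature.NumberTheory.Automorphic

/-! ## §0 Generic: Kottwitz's combination from three per-period counts -/

section Generic

variable {G : Type*} [Group G] [TopologicalSpace G] [IsTopologicalGroup G] [LocallyCompactSpace G]
  [SecondCountableTopology G] [T2Space G] [MeasurableSpace G] [BorelSpace G]
  [∀ γ : G, MeasurableSpace (G ⧸ Subgroup.centralizer ({γ} : Set G))]
  [∀ γ : G, BorelSpace (G ⧸ Subgroup.centralizer ({γ} : Set G))]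

/-- **KOTTWITZ'S COMBINATION `(νK₁)⁻¹Φ(𝟙_{K₁}) + (νK₂)⁻¹Φ(𝟙_{K₂}) − (νK₃)⁻¹Φ(𝟙_{K₃})` VANISHES as soon as the per-period fixed-coset counts satisfy
`#₁ + #₂ = #₃`** — for `m` canonical, `γ` with closed class and commutative centraliser with compact open compact core generated by `τ` modulo it (★
`classOrbitalIntegral_indicator_complex_eq_mul_natCard_quotient_zpowers` turns each term into a count), `K₁, K₂, K₃` compact open.
[cite: Kottwitz1988, §2 Theorem 2] [cite: Laumon1995, Lemma (5.3.2)] -/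
theorem epCombination_eq_zero_of_natCard_quotient_add_eq {P : G → Prop} (hP : ∀ g x : G, P g → P (x * g * x⁻¹))
    {ν : Measure G} [ν.IsHaarMeasure] [ν.IsMulRightInvariant] {m : OrbitalMeasureFamily G} (hm : m.IsCanonical P ν)
    {γ : G} (hγ : P γ) (hcomm : ∀ a b : Subgroup.centralizer ({γ} : Set G), a * b = b * a)
    (hc : IsCompact (compactCore (Subgroup.centralizer ({γ} : Set G)))) (ho : IsOpen (compactCore (Subgroup.centralizer ({γ} : Set G))))
    (τ : Subgroup.centralizer ({γ} : Set G))
    (hgen : ∀ c : Subgroup.centralizer ({γ} : Set G), ∃ n : ℤ, c * (τ ^ n)⁻¹ ∈ compactCore (Subgroup.centralizer ({γ} : Set G)))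
    (hfree : ∀ n : ℤ, τ ^ n ∈ compactCore (Subgroup.centralizer ({γ} : Set G)) → n = 0)
    (hO : IsClosed {g | ∃ y : G, y * γ * y⁻¹ = g})
    (K₁ K₂ K₃ : Subgroup G) (h₁o : IsOpen (K₁ : Set G)) (h₁c : IsCompact (K₁ : Set G)) (h₂o : IsOpen (K₂ : Set G)) (h₂c : IsCompact (K₂ : Set G))
    (h₃o : IsOpen (K₃ : Set G)) (h₃c : IsCompact (K₃ : Set G))
    (hcount : Finite (Quotient ((orbitRel (Subgroup.zpowers τ) (G ⧸ K₁)).comap (Subtype.val : ↥(fixedBy (G ⧸ K₁) γ) → G ⧸ K₁))) → Finite (Quotient ((orbitRel (Subgroup.zpowers τ) (G ⧸ K₂)).comap (Subtype.val : ↥(fixedBy (G ⧸ K₂) γ) → G ⧸ K₂))) → Finite (Quotient ((orbitRel (Subgroup.zpowers τ) (G ⧸ K₃)).comap (Subtype.val : ↥(fixedBy (G ⧸ K₃) γ) → G ⧸ K₃))) →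
      Nat.card (Quotient ((orbitRel (Subgroup.zpowers τ) (G ⧸ K₁)).comap (Subtype.val : ↥(fixedBy (G ⧸ K₁) γ) → G ⧸ K₁))) + Nat.card (Quotient ((orbitRel (Subgroup.zpowers τ) (G ⧸ K₂)).comap (Subtype.val : ↥(fixedBy (G ⧸ K₂) γ) → G ⧸ K₂))) = Nat.card (Quotient ((orbitRel (Subgroup.zpowers τ) (G ⧸ K₃)).comap (Subtype.val : ↥(fixedBy (G ⧸ K₃) γ) → G ⧸ K₃)))) :
    (((ν K₁).toReal : ℂ))⁻¹ * classOrbitalIntegral m ((K₁ : Set G).indicator fun _ => (1 : ℂ)) (ConjClasses.mk γ) +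
        (((ν K₂).toReal : ℂ))⁻¹ * classOrbitalIntegral m ((K₂ : Set G).indicator fun _ => (1 : ℂ)) (ConjClasses.mk γ) -
        (((ν K₃).toReal : ℂ))⁻¹ * classOrbitalIntegral m ((K₃ : Set G).indicator fun _ => (1 : ℂ)) (ConjClasses.mk γ) = 0 := by
  have hR₁ := classOrbitalIntegral_indicator_complex_eq_mul_natCard_quotient_zpowers hP hm hγ hcomm hc ho τ hgen hfree K₁ h₁o h₁c hO
  have hR₂ := classOrbitalIntegral_indicator_complex_eq_mul_natCard_quotient_zpowers hP hm hγ hcomm hc ho τ hgen hfree K₂ h₂o h₂c hO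
  have hR₃ := classOrbitalIntegral_indicator_complex_eq_mul_natCard_quotient_zpowers hP hm hγ hcomm hc ho τ hgen hfree K₃ h₃o h₃c hO
  have hsum := hcount (classOrbitalIntegral_indicator_eq_mul_natCard_quotient_zpowers hP hm hγ hcomm hc ho τ hgen hfree K₁ h₁o h₁c hO).1
    (classOrbitalIntegral_indicator_eq_mul_natCard_quotient_zpowers hP hm hγ hcomm hc ho τ hgen hfree K₂ h₂o h₂c hO).1
    (classOrbitalIntegral_indicator_eq_mul_natCard_quotient_zpowers hP hm hγ hcomm hc ho τ hgen hfree K₃ h₃o h₃c hO).1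
  have hvol : ∀ C : Subgroup G, IsOpen (C : Set G) → IsCompact (C : Set G) → (((ν C).toReal : ℝ) : ℂ) ≠ 0 := by
    intro C hCo hCc
    exact_mod_cast (ENNReal.toReal_pos (hCo.measure_pos ν ⟨1, C.one_mem⟩).ne' hCc.measure_lt_top.ne).ne'
  rw [hR₁, hR₂, hR₃, ← mul_assoc, inv_mul_cancel₀ (hvol _ h₁o h₁c), one_mul, ← mul_assoc, inv_mul_cancel₀ (hvol _ h₂o h₂c), one_mul,
    ← mul_assoc, inv_mul_cancel₀ (hvol _ h₃o h₃c), one_mul, ← Nat.cast_add, hsum, sub_self]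

end Generic

end Literature.NumberTheory.Automorphic

namespace Literature.NumberTheory.Rogawski1990

open Literature.NumberTheory.Automorphic Literature.NumberTheory.Automorphic.UnitaryGroup Literature.NumberTheory.Automorphic.HermitianLatticeTree
  Literature.NumberTheory.GaloisRepresentations

section TameRamified

variable (L : Type) [Field L] [NumberField L] [IsCMField L] {v : HeightOneSpectrum (𝓞 ↥(maximalRealSubfield L))}
  (w : PlacesOver L v) (hw : IsCMField.complexConj L • w.1 = w.1)
  (he : v.asIdeal.ramificationIdx' w.1.asIdeal ≠ 1) (h2 : IsUnit (2 : 𝒪[(w.1.adicCompletion L)]))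
  (η : (w.1.adicCompletion L)ˣ) (hη : Valued.v (η : (w.1.adicCompletion L)) = WithZero.exp (-1 : ℤ))
  [MeasurableSpace ((cmDatum L 2 (Matrix.of fun i j : Fin 2 => if i.val + j.val + 1 = 2 then (1 : L) else 0)).Local v)] [BorelSpace ((cmDatum L 2 (Matrix.of fun i j : Fin 2 => if i.val + j.val + 1 = 2 then (1 : L) else 0)).Local v)]
  [∀ γ : ((cmDatum L 2 (Matrix.of fun i j : Fin 2 => if i.val + j.val + 1 = 2 then (1 : L) else 0)).Local v), MeasurableSpace (((cmDatum L 2 (Matrix.of fun i j : Fin 2 => if i.val + j.val + 1 = 2 then (1 : L) else 0)).Local v) ⧸ Subgroup.centralizer ({γ} : Set ((cmDatum L 2 (Matrix.of fun i j : Fin 2 => if i.val + j.val + 1 = 2 then (1 : L) else 0)).Local v)))]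
  [∀ γ : ((cmDatum L 2 (Matrix.of fun i j : Fin 2 => if i.val + j.val + 1 = 2 then (1 : L) else 0)).Local v), BorelSpace (((cmDatum L 2 (Matrix.of fun i j : Fin 2 => if i.val + j.val + 1 = 2 then (1 : L) else 0)).Local v) ⧸ Subgroup.centralizer ({γ} : Set ((cmDatum L 2 (Matrix.of fun i j : Fin 2 => if i.val + j.val + 1 = 2 then (1 : L) else 0)).Local v)))]
  (ν : Measure ((cmDatum L 2 (Matrix.of fun i j : Fin 2 => if i.val + j.val + 1 = 2 then (1 : L) else 0)).Local v)) [IsHaarMeasure ν] [ν.IsMulRightInvariant]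

omit [IsCMField L] in
/-- `↑(glDiagonal ![1, η]) = diagonal ![1, ↑η]`. [cite: Serre1980Trees, II.1.1] -/
private theorem coe_glDiagonal_one_unit'' (ϖ : (w.1.adicCompletion L)ˣ) :
    ((glDiagonal 2 (w.1.adicCompletion L) ![1, ϖ] : GL (Fin 2) (w.1.adicCompletion L)) : Matrix (Fin 2) (Fin 2) (w.1.adicCompletion L)) = Matrix.diagonal ![(1 : (w.1.adicCompletion L)), (ϖ : (w.1.adicCompletion L))] := by
  rw [coe_glDiagonal]
  congr 1
  funext i
  fin_cases i <;> rfl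

/-! ## §1 (N) at a class whose one-place image is a regular diagonal matrix -/

set_option maxHeartbeats 1000000 in
set_option synthInstance.maxHeartbeats 200000 in
include hw he h2 hη in
/-- **(N) AT A REGULAR DIAGONAL CLASS, TAMELY RAMIFIED PLACE.**  For `δ ∈ U(Φ₂)(L⁺_v)` regular with `e_w δ = diag(d)`, `d₀ ≠ d₁`:
`(ν K♯)⁻¹Φ(⟦δ⟧,𝟙_{K♯}) + (ν K)⁻¹Φ(⟦δ⟧,𝟙_K) − (ν I)⁻¹Φ(⟦δ⟧,𝟙_I) = 0` at `(K♯_η, K, K♯_η ⊓ K)` — per period of the split-torus generator `τ` (★ p843441) each term is a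
fixed-coset count (★ p843359); the counts vanish off the compact torus (★ p843468) and satisfy «vertices = edges» on it (★ (S8a) + ★ (S7b)).
[cite: Kottwitz1988, §2 Theorem 2] [cite: Serre1980Trees, I.6.4, II.1.3] [cite: Rogawski1990, §12.6 p. 174] -/
theorem epNonEllipticRelation_vertexEdgeLevels_of_diagonal_of_ramified
    {m : OrbitalMeasureFamily ((cmDatum L 2 (Matrix.of fun i j : Fin 2 => if i.val + j.val + 1 = 2 then (1 : L) else 0)).Local v)}
    (hm : m.IsCanonical (fun γ => IsRegularElt (γ.val : GL (Fin 2) (UnitaryGroup.LocalRing L v))) ν)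
    (δ : ((cmDatum L 2 (Matrix.of fun i j : Fin 2 => if i.val + j.val + 1 = 2 then (1 : L) else 0)).Local v)) (hreg : IsRegularElt (δ.val : GL (Fin 2) (UnitaryGroup.LocalRing L v)))
    {d : Fin 2 → (w.1.adicCompletion L)}
    (hδ : ((((localNonsplitEquiv (IsCMField.complexConj L) (Matrix.of fun i j : Fin 2 => if i.val + j.val + 1 = 2 then (1 : L) else 0) (IsCMField.complexConj_ne_one L) w hw) δ : ↥(unitaryGroupOfForm (galAdicCompletionMap (L := L) (IsCMField.complexConj L) hw) (placeForm (Matrix.of fun i j : Fin 2 => if i.val + j.val + 1 = 2 then (1 : L) else 0) w.1))) : GL (Fin 2) (w.1.adicCompletion L)) : Matrix (Fin 2) (Fin 2) (w.1.adicCompletion L)) = Matrix.diagonal d) (hd01 : d 0 ≠ d 1) :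
    (((ν ((((glInt 2 (w.1.adicCompletion L)).map (MulAut.conj (glDiagonal 2 (w.1.adicCompletion L) ![1, η])).toMonoidHom).comap (((unitaryGroupOfForm (galAdicCompletionMap (L := L) (IsCMField.complexConj L) hw) (placeForm (Matrix.of fun i j : Fin 2 => if i.val + j.val + 1 = 2 then (1 : L) else 0) w.1))).subtype.comp (localNonsplitEquiv (IsCMField.complexConj L) (Matrix.of fun i j : Fin 2 => if i.val + j.val + 1 = 2 then (1 : L) else 0) (IsCMField.complexConj_ne_one L) w hw).toMonoidHom : ((cmDatum L 2 (Matrix.of fun i j : Fin 2 => if i.val + j.val + 1 = 2 then (1 : L) else 0)).Local v) →* GL (Fin 2) (w.1.adicCompletion L))) : Subgroup ((cmDatum L 2 (Matrix.of fun i j : Fin 2 => if i.val + j.val + 1 = 2 then (1 : L) else 0)).Local v))).toReal : ℂ))⁻¹ * classOrbitalIntegral m ((((((glInt 2 (w.1.adicCompletion L)).map (MulAut.conj (glDiagonal 2 (w.1.adicCompletion L) ![1, η])).toMonoidHom).comap (((unitaryGroupOfForm (galAdicCompletionMap (L := L) (IsCMField.complexConj L) hw) (placeForm (Matrix.of fun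 i j : Fin 2 => if i.val + j.val + 1 = 2 then (1 : L) else 0) w.1))).subtype.comp (localNonsplitEquiv (IsCMField.complexConj L) (Matrix.of fun i j : Fin 2 => if i.val + j.val + 1 = 2 then (1 : L) else 0) (IsCMField.complexConj_ne_one L) w hw).toMonoidHom : ((cmDatum L 2 (Matrix.of fun i j : Fin 2 => if i.val + j.val + 1 = 2 then (1 : L) else 0)).Local v) →* GL (Fin 2) (w.1.adicCompletion L))) : Subgroup ((cmDatum L 2 (Matrix.of fun i j : Fin 2 => if i.val + j.val + 1 = 2 then (1 : L) else 0)).Local v)) : Set ((cmDatum L 2 (Matrix.of fun i j : Fin 2 => if i.val + j.val + 1 = 2 then (1 : L) else 0)).Local v)).indicator fun _ => (1 : ℂ)) (ConjClasses.mk δ) +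
        (((ν (cmLocalIntegralLevel L 2 (Matrix.of fun i j : Fin 2 => if i.val + j.val + 1 = 2 then (1 : L) else 0) v)).toReal : ℂ))⁻¹ * classOrbitalIntegral m (((cmLocalIntegralLevel L 2 (Matrix.of fun i j : Fin 2 => if i.val + j.val + 1 = 2 then (1 : L) else 0) v) : Set ((cmDatum L 2 (Matrix.of fun i j : Fin 2 => if i.val + j.val + 1 = 2 then (1 : L) else 0)).Local v)).indicator fun _ => (1 : ℂ)) (ConjClasses.mk δ) -
        (((ν (((((glInt 2 (w.1.adicCompletion L)).map (MulAut.conj (glDiagonal 2 (w.1.adicCompletion L) ![1, η])).toMonoidHom).comap (((unitaryGroupOfForm (galAdicCompletionMap (L := L) (IsCMField.complexConj L) hw) (placeForm (Matrix.of fun i j : Fin 2 => if i.val + j.val + 1 = 2 then (1 : L) else 0) w.1))).subtype.comp (localNonsplitEquiv (IsCMField.complexConj L) (Matrix.of fun i j : Fin 2 => if i.val + j.val + 1 = 2 then (1 : L) else 0) (IsCMField.complexConj_ne_one L) w hw).toMonoidHom : ((cmDatum L 2 (Matrix.of fun i j : Fin 2 => if i.val + j.val + 1 = 2 then (1 : L)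 else 0)).Local v) →* GL (Fin 2) (w.1.adicCompletion L))) : Subgroup ((cmDatum L 2 (Matrix.of fun i j : Fin 2 => if i.val + j.val + 1 = 2 then (1 : L) else 0)).Local v)) ⊓ (cmLocalIntegralLevel L 2 (Matrix.of fun i j : Fin 2 => if i.val + j.val + 1 = 2 then (1 : L) else 0) v))).toReal : ℂ))⁻¹ * classOrbitalIntegral m (((((((glInt 2 (w.1.adicCompletion L)).map (MulAut.conj (glDiagonal 2 (w.1.adicCompletion L) ![1, η])).toMonoidHom).comap (((unitaryGroupOfForm (galAdicCompletionMap (L := L) (IsCMField.complexConj L) hw) (placeForm (Matrix.of fun i j : Fin 2 => if i.val + j.val + 1 = 2 then (1 : L) else 0) w.1))).subtype.comp (localNonsplitEquiv (IsCMField.complexConj L) (Matrix.of fun i j : Fin 2 => if i.val + j.val + 1 = 2 then (1 : L) else 0) (IsCMField.complexConj_ne_one L) w hw).toMonoidHom : ((cmDatum L 2 (Matrix.of fun i j : Fin 2 => if i.val + j.val + 1 = 2 then (1 : L) else 0)).Local v) →* GL (Fin 2) (w.1.adicCompletion L))) : Subgroup ((cmDatum L 2 (Matrix.of fun i j : Fin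 2 => if i.val + j.val + 1 = 2 then (1 : L) else 0)).Local v)) ⊓ (cmLocalIntegralLevel L 2 (Matrix.of fun i j : Fin 2 => if i.val + j.val + 1 = 2 then (1 : L) else 0) v)) : Set ((cmDatum L 2 (Matrix.of fun i j : Fin 2 => if i.val + j.val + 1 = 2 then (1 : L) else 0)).Local v)).indicator fun _ => (1 : ℂ)) (ConjClasses.mk δ) = 0 := by
  classical
  have hc1 : IsCMField.complexConj L ≠ 1 := IsCMField.complexConj_ne_one L
  haveI : Algebra.IsQuadraticExtension ↥(maximalRealSubfield L) L := IsCMField.isQuadraticExtension L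
  have hϖ' : IsUniformizingElement (η : (w.1.adicCompletion L)) := isUniformizingElement_of_v_eq hη
  haveI : IsDiscreteValuationRing 𝒪[(w.1.adicCompletion L)] := isDiscreteValuationRing_integer_of_compatible hη
  have hσv : ∀ x, valuation (w.1.adicCompletion L) ((galAdicCompletionMap (L := L) (IsCMField.complexConj L) hw) x) = valuation (w.1.adicCompletion L) x := fun x => valuation_galAdicCompletionMap_eq (IsCMField.complexConj L) v w hw x
  have hH2 : placeForm (Matrix.of fun i j : Fin 2 => if i.val + j.val + 1 = 2 then (1 : L) else 0) w.1 = (!![0, 1; 1, 0] : Matrix (Fin 2) (Fin 2) (w.1.adicCompletion L)) := placeForm_antidiagTwo_eq_antidiag L v w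
  -- regularity of `d`
  have hdreg : ∀ i j : Fin 2, i ≠ j → IsUnit (d i - d j) := by
    intro i j hij
    rw [isUnit_iff_ne_zero, sub_ne_zero]
    fin_cases i <;> fin_cases j
    · exact absurd rfl hij
    · exact hd01
    · exact fun h => hd01 h.symm
    · exact absurd rfl hij
  -- the three levels are compact open; the class of `δ` is closed; the compact-core facts
  obtain ⟨hKc, hKo⟩ := isCompact_isOpen_cmLocalIntegralLevel L 2 (Matrix.of fun i j : Fin 2 => if i.val + j.val + 1 = 2 then (1 : L) else 0) v
  obtain ⟨hSc, hSo⟩ := isCompact_isOpen_comap_map_conj_glInt L w hw (glDiagonal 2 (w.1.adicCompletion L) ![1, η])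
  obtain ⟨hIc, hIo⟩ := isCompact_isOpen_comap_map_conj_glInt_inf_cmLocalIntegralLevel L w hw (glDiagonal 2 (w.1.adicCompletion L) ![1, η])
  have hO := isClosed_conjClass_local_of_isRegularElt L 2 (Matrix.of fun i j : Fin 2 => if i.val + j.val + 1 = 2 then (1 : L) else 0) v (antidiagOne_isHermitian L 2) (isUnit_antidiagOne_det L 2).ne_zero δ hreg
  obtain ⟨hcomm, hcc, hco⟩ : (∀ a b : Subgroup.centralizer ({δ} : Set ((cmDatum L 2 (Matrix.of fun i j : Fin 2 => if i.val + j.val + 1 = 2 then (1 : L) else 0)).Local v)), a * b = b * a) ∧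
      IsCompact (compactCore (Subgroup.centralizer ({δ} : Set ((cmDatum L 2 (Matrix.of fun i j : Fin 2 => if i.val + j.val + 1 = 2 then (1 : L) else 0)).Local v)))) ∧ IsOpen (compactCore (Subgroup.centralizer ({δ} : Set ((cmDatum L 2 (Matrix.of fun i j : Fin 2 => if i.val + j.val + 1 = 2 then (1 : L) else 0)).Local v)))) :=
    compactCore_centralizer_local_facts_of_isRegularElt (IsCMField.complexConj L) 2 (Matrix.of fun i j : Fin 2 => if i.val + j.val + 1 = 2 then (1 : L) else 0) hc1
      (by rw [← map_cmConjRingHom_eq_map_complexConj]; exact antidiagOne_isHermitian L 2) (isUnit_antidiagOne_det L 2) δ hreg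
  have hP : ∀ g x : ((cmDatum L 2 (Matrix.of fun i j : Fin 2 => if i.val + j.val + 1 = 2 then (1 : L) else 0)).Local v), IsRegularElt (g.val : GL (Fin 2) (UnitaryGroup.LocalRing L v)) → IsRegularElt ((x * g * x⁻¹).val : GL (Fin 2) (UnitaryGroup.LocalRing L v)) :=
    fun g x hg => isRegularElt_val_conj L 2 (Matrix.of fun i j : Fin 2 => if i.val + j.val + 1 = 2 then (1 : L) else 0) v g x hg
  -- the split-torus generator `τ`, `e_w τ = diag(η, (σ_w η)⁻¹)`
  have hJ₀₀ : placeForm (Matrix.of fun i j : Fin 2 => if i.val + j.val + 1 = 2 then (1 : L) else 0) w.1 0 0 = 0 := by rw [hH2]; rfl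
  have hJ₁₁ : placeForm (Matrix.of fun i j : Fin 2 => if i.val + j.val + 1 = 2 then (1 : L) else 0) w.1 1 1 = 0 := by rw [hH2]; rfl
  have hJ₀₁ : placeForm (Matrix.of fun i j : Fin 2 => if i.val + j.val + 1 = 2 then (1 : L) else 0) w.1 0 1 ≠ 0 := by rw [hH2]; exact one_ne_zero
  obtain ⟨τ, hτ, hgen, hfree⟩ : ∃ τ : Subgroup.centralizer ({δ} : Set ((cmDatum L 2 (Matrix.of fun i j : Fin 2 => if i.val + j.val + 1 = 2 then (1 : L) else 0)).Local v)),
      ((((localNonsplitEquiv (IsCMField.complexConj L) (Matrix.of fun i j : Fin 2 => if i.val + j.val + 1 = 2 then (1 : L) else 0) (IsCMField.complexConj_ne_one L) w hw) (τ : ((cmDatum L 2 (Matrix.of fun i j : Fin 2 => if i.val + j.val + 1 = 2 then (1 : L) else 0)).Local v)) : ↥(unitaryGroupOfForm (galAdicCompletionMap (L := L) (IsCMField.complexConj L) hw) (placeForm (Matrix.of fun i j : Fin 2 => if i.val + j.val + 1 = 2 then (1 : L) else 0) w.1))) : GL (Fin 2) (w.1.adicCompletion L)) : Matrix (Fin 2)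 (Fin 2) (w.1.adicCompletion L)) = Matrix.diagonal ![(η : (w.1.adicCompletion L)), ((galAdicCompletionMap (L := L) (IsCMField.complexConj L) hw) (η : (w.1.adicCompletion L)))⁻¹] ∧
      (∀ c' : Subgroup.centralizer ({δ} : Set ((cmDatum L 2 (Matrix.of fun i j : Fin 2 => if i.val + j.val + 1 = 2 then (1 : L) else 0)).Local v)), ∃ n : ℤ, c' * (τ ^ n)⁻¹ ∈ compactCore (Subgroup.centralizer ({δ} : Set ((cmDatum L 2 (Matrix.of fun i j : Fin 2 => if i.val + j.val + 1 = 2 then (1 : L) else 0)).Local v)))) ∧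
      (∀ n : ℤ, τ ^ n ∈ compactCore (Subgroup.centralizer ({δ} : Set ((cmDatum L 2 (Matrix.of fun i j : Fin 2 => if i.val + j.val + 1 = 2 then (1 : L) else 0)).Local v))) → n = 0) :=
    exists_splitTorus_generator_local_of_nonsplit (IsCMField.complexConj L) (Matrix.of fun i j : Fin 2 => if i.val + j.val + 1 = 2 then (1 : L) else 0) hc1 w hw hJ₀₀ hJ₁₁ hJ₀₁ hϖ' hδ hdreg
  have hφ := isClosedEmbedding_subtype_comp_localNonsplitEquiv (IsCMField.complexConj L) 2 (Matrix.of fun i j : Fin 2 => if i.val + j.val + 1 = 2 then (1 : L) else 0) hc1 w hw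
  have hδφ : ((((((unitaryGroupOfForm (galAdicCompletionMap (L := L) (IsCMField.complexConj L) hw) (placeForm (Matrix.of fun i j : Fin 2 => if i.val + j.val + 1 = 2 then (1 : L) else 0) w.1))).subtype.comp (localNonsplitEquiv (IsCMField.complexConj L) (Matrix.of fun i j : Fin 2 => if i.val + j.val + 1 = 2 then (1 : L) else 0) (IsCMField.complexConj_ne_one L) w hw).toMonoidHom)) δ : GL (Fin 2) (w.1.adicCompletion L)) : Matrix (Fin 2) (Fin 2) (w.1.adicCompletion L)) = Matrix.diagonal d := hδ
  refine epCombination_eq_zero_of_natCard_quotient_add_eq (G := ((cmDatum L 2 (Matrix.of fun i j : Fin 2 => if i.val + j.val + 1 = 2 then (1 : L) else 0)).Local v))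
    (P := fun γ : ((cmDatum L 2 (Matrix.of fun i j : Fin 2 => if i.val + j.val + 1 = 2 then (1 : L) else 0)).Local v) => IsRegularElt (γ.val : GL (Fin 2) (UnitaryGroup.LocalRing L v))) hP hm hreg hcomm hcc hco τ hgen hfree hO
    ((((glInt 2 (w.1.adicCompletion L)).map (MulAut.conj (glDiagonal 2 (w.1.adicCompletion L) ![1, η])).toMonoidHom).comap (((unitaryGroupOfForm (galAdicCompletionMap (L := L) (IsCMField.complexConj L) hw) (placeForm (Matrix.of fun i j : Fin 2 => if i.val + j.val + 1 = 2 then (1 : L) else 0) w.1))).subtype.comp (localNonsplitEquiv (IsCMField.complexConj L) (Matrix.of fun i j : Fin 2 => if i.val + j.val + 1 = 2 then (1 : L) else 0) (IsCMField.complexConj_ne_one L) w hw).toMonoidHom : ((cmDatum L 2 (Matrix.of fun i j : Fin 2 => if i.val + j.val + 1 = 2 then (1 : L) else 0)).Local v) →* GL (Fin 2) (w.1.adicCompletion L))) : Subgroup ((cmDatum L 2 (Matrix.of fun i j : Fin 2 => if i.val + j.val + 1 = 2 then (1 : L) else 0)).Local v)) (cmLocalIntegralLevel L 2 (Matrix.of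 fun i j : Fin 2 => if i.val + j.val + 1 = 2 then (1 : L) else 0) v) (((((glInt 2 (w.1.adicCompletion L)).map (MulAut.conj (glDiagonal 2 (w.1.adicCompletion L) ![1, η])).toMonoidHom).comap (((unitaryGroupOfForm (galAdicCompletionMap (L := L) (IsCMField.complexConj L) hw) (placeForm (Matrix.of fun i j : Fin 2 => if i.val + j.val + 1 = 2 then (1 : L) else 0) w.1))).subtype.comp (localNonsplitEquiv (IsCMField.complexConj L) (Matrix.of fun i j : Fin 2 => if i.val + j.val + 1 = 2 then (1 : L) else 0) (IsCMField.complexConj_ne_one L) w hw).toMonoidHom : ((cmDatum L 2 (Matrix.of fun i j : Fin 2 => if i.val + j.val + 1 = 2 then (1 : L) else 0)).Local v) →* GL (Fin 2) (w.1.adicCompletion L))) : Subgroup ((cmDatum L 2 (Matrix.of fun i j : Fin 2 => if i.val + j.val + 1 = 2 then (1 : L) else 0)).Local v)) ⊓ (cmLocalIntegralLevel L 2 (Matrix.of fun i j : Fin 2 => if i.val + j.val + 1 = 2 then (1 : L) else 0) v)) hSo hSc hKo hKc hIo hIc fun hfinS hfinK hfinI => ?_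
  -- the counts: off the compact torus everything vanishes, on it «vertices = edges per period»
  by_cases hd0 : valuation (w.1.adicCompletion L) (d 0) = 1
  · -- unit entries: the tree count (★ (S8a) + ★ (S7b))
    have hd1 : valuation (w.1.adicCompletion L) (d 1) = 1 := by
      rw [valuation_apply_one_eq_inv (galAdicCompletionMap (L := L) (IsCMField.complexConj L) hw) hσv hJ₀₁ ((localNonsplitEquiv (IsCMField.complexConj L) (Matrix.of fun i j : Fin 2 => if i.val + j.val + 1 = 2 then (1 : L) else 0) (IsCMField.complexConj_ne_one L) w hw) δ).2 hδ, hd0, inv_one]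
    have hde : ∀ i, valuation (w.1.adicCompletion L) (d i) = 1 := by
      intro i; fin_cases i
      · exact hd0
      · exact hd1
    have hUeq : (unitaryGroupOfForm (galAdicCompletionMap (L := L) (IsCMField.complexConj L) hw) (placeForm (Matrix.of fun i j : Fin 2 => if i.val + j.val + 1 = 2 then (1 : L) else 0) w.1)) = (unitaryGroupOfForm (galAdicCompletionMap (L := L) (IsCMField.complexConj L) hw) (!![0, 1; 1, 0] : Matrix (Fin 2) (Fin 2) (w.1.adicCompletion L))) := by rw [hH2]
    have hdD := coe_glDiagonal_one_unit'' L w η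
    have hg₁ := isModularLattice_latt_glDiagonal_one L v w hw η
    rw [hH2] at hg₁
    have hadj₁ : scaleLattice (η : (w.1.adicCompletion L)) (latt (1 : Matrix (Fin 2) (Fin 2) (w.1.adicCompletion L))) ≤ latt (((glDiagonal 2 (w.1.adicCompletion L) ![1, η]) : GL (Fin 2) (w.1.adicCompletion L)) : Matrix (Fin 2) (Fin 2) (w.1.adicCompletion L)) := by
      rw [hdD]; exact scaleLattice_latt_one_le_latt_diagonal hϖ'
    have hadj₂ : latt (((glDiagonal 2 (w.1.adicCompletion L) ![1, η]) : GL (Fin 2) (w.1.adicCompletion L)) : Matrix (Fin 2) (Fin 2) (w.1.adicCompletion L)) ≤ latt (1 : Matrix (Fin 2) (Fin 2) (w.1.adicCompletion L)) := by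
      rw [hdD]; exact latt_diagonal_le_latt_one hϖ'
    have hτc : (τ : ((cmDatum L 2 (Matrix.of fun i j : Fin 2 => if i.val + j.val + 1 = 2 then (1 : L) else 0)).Local v)) * δ = δ * (τ : ((cmDatum L 2 (Matrix.of fun i j : Fin 2 => if i.val + j.val + 1 = 2 then (1 : L) else 0)).Local v)) := Subgroup.mem_centralizer_singleton_iff.1 τ.2
    -- the model `eU : U₂ ≃* U(σ_w, antidiag(1,1))`, with its values kept behind the generic lemma `MulEquiv.subgroupCongr_apply`
    -- (no definitional comparison of `placeForm Φ₂ w` with `!![0,1;1,0]` is ever left to the kernel)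
    obtain ⟨eU, heU⟩ : ∃ eU : ((cmDatum L 2 (Matrix.of fun i j : Fin 2 => if i.val + j.val + 1 = 2 then (1 : L) else 0)).Local v) ≃* ↥(unitaryGroupOfForm (galAdicCompletionMap (L := L) (IsCMField.complexConj L) hw) (!![0, 1; 1, 0] : Matrix (Fin 2) (Fin 2) (w.1.adicCompletion L))), ∀ g : ((cmDatum L 2 (Matrix.of fun i j : Fin 2 => if i.val + j.val + 1 = 2 then (1 : L) else 0)).Local v), ((eU g : ↥(unitaryGroupOfForm (galAdicCompletionMap (L := L) (IsCMField.complexConj L) hw) (!![0, 1; 1, 0] : Matrix (Fin 2) (Fin 2) (w.1.adicCompletion L)))) : GL (Fin 2) (w.1.adicCompletion L)) = (((localNonsplitEquiv (IsCMField.complexConj L) (Matrix.of fun i j : Fin 2 => if i.val + j.val + 1 = 2 then (1 : L) else 0) (IsCMField.complexConj_ne_one L) w hw) g : ↥(unitaryGroupOfForm (galAdicCompletionMap (L := L) (IsCMField.complexConj L) hw) (placeForm (Matrix.of fun i j : Fin 2 => if i.val + j.val + 1 = 2 then (1 : L) else 0) w.1))) : GL (Fin 2) (w.1.adicCompletion L))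 :=
      ⟨((localNonsplitEquiv (IsCMField.complexConj L) (Matrix.of fun i j : Fin 2 => if i.val + j.val + 1 = 2 then (1 : L) else 0) (IsCMField.complexConj_ne_one L) w hw)).toMulEquiv.trans (MulEquiv.subgroupCongr hUeq), fun g => MulEquiv.subgroupCongr_apply hUeq _⟩
    have hCA : ∀ g : ((cmDatum L 2 (Matrix.of fun i j : Fin 2 => if i.val + j.val + 1 = 2 then (1 : L) else 0)).Local v), g ∈ (cmLocalIntegralLevel L 2 (Matrix.of fun i j : Fin 2 => if i.val + j.val + 1 = 2 then (1 : L) else 0) v) ↔ ((eU g : ↥(unitaryGroupOfForm (galAdicCompletionMap (L := L) (IsCMField.complexConj L) hw) (!![0, 1; 1, 0] : Matrix (Fin 2) (Fin 2) (w.1.adicCompletion L)))) : GL (Fin 2) (w.1.adicCompletion L)) ∈ glInt 2 (w.1.adicCompletion L) := fun g => by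
      rw [heU]; exact mem_localIntegralLevel_iff_of_smul_eq (IsCMField.complexConj L) 2 _ hc1 w hw g
    have hCB : ∀ g : ((cmDatum L 2 (Matrix.of fun i j : Fin 2 => if i.val + j.val + 1 = 2 then (1 : L) else 0)).Local v), g ∈ ((((glInt 2 (w.1.adicCompletion L)).map (MulAut.conj (glDiagonal 2 (w.1.adicCompletion L) ![1, η])).toMonoidHom).comap (((unitaryGroupOfForm (galAdicCompletionMap (L := L) (IsCMField.complexConj L) hw) (placeForm (Matrix.of fun i j : Fin 2 => if i.val + j.val + 1 = 2 then (1 : L) else 0) w.1))).subtype.comp (localNonsplitEquiv (IsCMField.complexConj L) (Matrix.of fun i j : Fin 2 => if i.val + j.val + 1 = 2 then (1 : L) else 0) (IsCMField.complexConj_ne_one L) w hw).toMonoidHom : ((cmDatum L 2 (Matrix.of fun i j : Fin 2 => if i.val + j.val + 1 = 2 then (1 : L) else 0)).Local v) →* GL (Fin 2) (w.1.adicCompletion L))) : Subgroup ((cmDatum L 2 (Matrix.of fun i j : Fin 2 => if i.val + j.val + 1 = 2 then (1 : L) else 0)).Local v)) ↔ ((eU g : ↥(unitaryGroupOfForm (galAdicCompletionMap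 (L := L) (IsCMField.complexConj L) hw) (!![0, 1; 1, 0] : Matrix (Fin 2) (Fin 2) (w.1.adicCompletion L)))) : GL (Fin 2) (w.1.adicCompletion L)) ∈ (glInt 2 (w.1.adicCompletion L)).map (MulAut.conj (glDiagonal 2 (w.1.adicCompletion L) ![1, η])).toMonoidHom := fun g => by
      rw [heU]; exact mem_comap_map_conj_glInt_iff L w hw (glDiagonal 2 (w.1.adicCompletion L) ![1, η]) g
    have ht' : (((eU (τ : ((cmDatum L 2 (Matrix.of fun i j : Fin 2 => if i.val + j.val + 1 = 2 then (1 : L) else 0)).Local v)) : ↥(unitaryGroupOfForm (galAdicCompletionMap (L := L) (IsCMField.complexConj L) hw) (!![0, 1; 1, 0] : Matrix (Fin 2) (Fin 2) (w.1.adicCompletion L)))) : GL (Fin 2) (w.1.adicCompletion L)) : Matrix (Fin 2) (Fin 2) (w.1.adicCompletion L)) = Matrix.diagonal ![(η : (w.1.adicCompletion L)), ((galAdicCompletionMap (L := L) (IsCMField.complexConj L) hw) (η : (w.1.adicCompletion L)))⁻¹] := by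
      rw [heU]; exact hτ
    have hγ' : (((eU δ : ↥(unitaryGroupOfForm (galAdicCompletionMap (L := L) (IsCMField.complexConj L) hw) (!![0, 1; 1, 0] : Matrix (Fin 2) (Fin 2) (w.1.adicCompletion L)))) : GL (Fin 2) (w.1.adicCompletion L)) : Matrix (Fin 2) (Fin 2) (w.1.adicCompletion L)) = Matrix.diagonal d := by
      rw [heU]; exact hδ
    have hsum := natCard_quotient_fixedBy_add_eq_natCard_quotient_fixedBy_inf (G := ((cmDatum L 2 (Matrix.of fun i j : Fin 2 => if i.val + j.val + 1 = 2 then (1 : L) else 0)).Local v)) (galAdicCompletionMap (L := L) (IsCMField.complexConj L) hw) hσv hϖ' eU hg₁ hadj₁ hadj₂ (cmLocalIntegralLevel L 2 (Matrix.of fun i j : Fin 2 => if i.val + j.val + 1 = 2 then (1 : L) else 0) v) ((((glInt 2 (w.1.adicCompletion L)).map (MulAut.conj (glDiagonal 2 (w.1.adicCompletion L) ![1, η])).toMonoidHom).comap (((unitaryGroupOfForm (galAdicCompletionMap (L := L) (IsCMField.complexConj L) hw) (placeForm (Matrix.of fun i j : Fin 2 => if i.val + j.val + 1 = 2 then (1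 : L) else 0) w.1))).subtype.comp (localNonsplitEquiv (IsCMField.complexConj L) (Matrix.of fun i j : Fin 2 => if i.val + j.val + 1 = 2 then (1 : L) else 0) (IsCMField.complexConj_ne_one L) w hw).toMonoidHom : ((cmDatum L 2 (Matrix.of fun i j : Fin 2 => if i.val + j.val + 1 = 2 then (1 : L) else 0)).Local v) →* GL (Fin 2) (w.1.adicCompletion L))) : Subgroup ((cmDatum L 2 (Matrix.of fun i j : Fin 2 => if i.val + j.val + 1 = 2 then (1 : L) else 0)).Local v)) (((((glInt 2 (w.1.adicCompletion L)).map (MulAut.conj (glDiagonal 2 (w.1.adicCompletion L) ![1, η])).toMonoidHom).comap (((unitaryGroupOfForm (galAdicCompletionMap (L := L) (IsCMField.complexConj L) hw) (placeForm (Matrix.of fun i j : Fin 2 => if i.val + j.val + 1 = 2 then (1 : L) else 0) w.1))).subtype.comp (localNonsplitEquiv (IsCMField.complexConj L) (Matrix.of fun i j : Fin 2 => if i.val + j.val + 1 = 2 then (1 : L) else 0) (IsCMField.complexConj_ne_one L) w hw).toMonoidHom : ((cmDatum L 2 (Matrix.of fun i j : Fin 2 => if i.val + j.val + 1 = 2 then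 (1 : L) else 0)).Local v) →* GL (Fin 2) (w.1.adicCompletion L))) : Subgroup ((cmDatum L 2 (Matrix.of fun i j : Fin 2 => if i.val + j.val + 1 = 2 then (1 : L) else 0)).Local v)) ⊓ (cmLocalIntegralLevel L 2 (Matrix.of fun i j : Fin 2 => if i.val + j.val + 1 = 2 then (1 : L) else 0) v))
      hCA hCB (fun g => Subgroup.mem_inf.trans and_comm)
      (forall_isSelfDualLattice_exists_latt_eq_of_ramified_antidiag (IsCMField.complexConj L) w hc1 hw he h2)
      (forall_isModularLattice_exists_latt_mul_eq_of_ramified (IsCMField.complexConj L) w hc1 hw he h2 hϖ' hdD)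
      (forall_flag_exists_latt_eq_of_ramified (IsCMField.complexConj L) w hc1 hw he h2 hϖ' hdD)
      δ (τ : ((cmDatum L 2 (Matrix.of fun i j : Fin 2 => if i.val + j.val + 1 = 2 then (1 : L) else 0)).Local v)) hτc ht' hγ' hde hfinK hfinS hfinI
    rw [add_comm]
    exact hsum
  · -- `|d₀| ≠ 1`: no fixed coset at all (★ p843468, read on the one-place model `subtype ∘ e_w`)
    have h00 : valuation (w.1.adicCompletion L) (((((((unitaryGroupOfForm (galAdicCompletionMap (L := L) (IsCMField.complexConj L) hw) (placeForm (Matrix.of fun i j : Fin 2 => if i.val + j.val + 1 = 2 then (1 : L) else 0) w.1))).subtype.comp (localNonsplitEquiv (IsCMField.complexConj L) (Matrix.of fun i j : Fin 2 => if i.val + j.val + 1 = 2 then (1 : L) else 0) (IsCMField.complexConj_ne_one L) w hw).toMonoidHom)) δ : GL (Fin 2) (w.1.adicCompletion L)) : Matrix (Fin 2) (Fin 2) (w.1.adicCompletion L)) 0 0) ≠ 1 := by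
      rwa [hδφ, Matrix.diagonal_apply_eq]
    have hzS : Nat.card (Quotient ((orbitRel (Subgroup.zpowers τ) (((cmDatum L 2 (Matrix.of fun i j : Fin 2 => if i.val + j.val + 1 = 2 then (1 : L) else 0)).Local v) ⧸ ((((glInt 2 (w.1.adicCompletion L)).map (MulAut.conj (glDiagonal 2 (w.1.adicCompletion L) ![1, η])).toMonoidHom).comap (((unitaryGroupOfForm (galAdicCompletionMap (L := L) (IsCMField.complexConj L) hw) (placeForm (Matrix.of fun i j : Fin 2 => if i.val + j.val + 1 = 2 then (1 : L) else 0) w.1))).subtype.comp (localNonsplitEquiv (IsCMField.complexConj L) (Matrix.of fun i j : Fin 2 => if i.val + j.val + 1 = 2 then (1 : L) else 0) (IsCMField.complexConj_ne_one L) w hw).toMonoidHom : ((cmDatum L 2 (Matrix.of fun i j : Fin 2 => if i.val + j.val + 1 = 2 then (1 : L) else 0)).Local v) →* GL (Fin 2) (w.1.adicCompletion L))) : Subgroup ((cmDatum L 2 (Matrix.of fun i j : Fin 2 => if i.val + j.val + 1 = 2 then (1 : L) else 0)).Local v)))).comap (Subtype.val : ↥(fixedBy (((cmDatum L 2 (Matrix.of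 fun i j : Fin 2 => if i.val + j.val + 1 = 2 then (1 : L) else 0)).Local v) ⧸ ((((glInt 2 (w.1.adicCompletion L)).map (MulAut.conj (glDiagonal 2 (w.1.adicCompletion L) ![1, η])).toMonoidHom).comap (((unitaryGroupOfForm (galAdicCompletionMap (L := L) (IsCMField.complexConj L) hw) (placeForm (Matrix.of fun i j : Fin 2 => if i.val + j.val + 1 = 2 then (1 : L) else 0) w.1))).subtype.comp (localNonsplitEquiv (IsCMField.complexConj L) (Matrix.of fun i j : Fin 2 => if i.val + j.val + 1 = 2 then (1 : L) else 0) (IsCMField.complexConj_ne_one L) w hw).toMonoidHom : ((cmDatum L 2 (Matrix.of fun i j : Fin 2 => if i.val + j.val + 1 = 2 then (1 : L) else 0)).Local v) →* GL (Fin 2) (w.1.adicCompletion L))) : Subgroup ((cmDatum L 2 (Matrix.of fun i j : Fin 2 => if i.val + j.val + 1 = 2 then (1 : L) else 0)).Local v))) δ) → ((cmDatum L 2 (Matrix.of fun i j : Fin 2 => if i.val + j.val + 1 = 2 then (1 : L) else 0)).Local v) ⧸ ((((glInt 2 (w.1.adicCompletion L)).map (MulAut.conj (glDiagonal 2 (w.1.adicCompletion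 L) ![1, η])).toMonoidHom).comap (((unitaryGroupOfForm (galAdicCompletionMap (L := L) (IsCMField.complexConj L) hw) (placeForm (Matrix.of fun i j : Fin 2 => if i.val + j.val + 1 = 2 then (1 : L) else 0) w.1))).subtype.comp (localNonsplitEquiv (IsCMField.complexConj L) (Matrix.of fun i j : Fin 2 => if i.val + j.val + 1 = 2 then (1 : L) else 0) (IsCMField.complexConj_ne_one L) w hw).toMonoidHom : ((cmDatum L 2 (Matrix.of fun i j : Fin 2 => if i.val + j.val + 1 = 2 then (1 : L) else 0)).Local v) →* GL (Fin 2) (w.1.adicCompletion L))) : Subgroup ((cmDatum L 2 (Matrix.of fun i j : Fin 2 => if i.val + j.val + 1 = 2 then (1 : L) else 0)).Local v))))) = 0 :=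
      natCard_quotient_fixedBy_eq_zero_of_valuation_apply_ne_one w.1 (((unitaryGroupOfForm (galAdicCompletionMap (L := L) (IsCMField.complexConj L) hw) (placeForm (Matrix.of fun i j : Fin 2 => if i.val + j.val + 1 = 2 then (1 : L) else 0) w.1))).subtype.comp (localNonsplitEquiv (IsCMField.complexConj L) (Matrix.of fun i j : Fin 2 => if i.val + j.val + 1 = 2 then (1 : L) else 0) (IsCMField.complexConj_ne_one L) w hw).toMonoidHom) hδφ hdreg hφ _ hSc h00 _
    have hzK : Nat.card (Quotient ((orbitRel (Subgroup.zpowers τ) (((cmDatum L 2 (Matrix.of fun i j : Fin 2 => if i.val + j.val + 1 = 2 then (1 : L) else 0)).Local v) ⧸ (cmLocalIntegralLevel L 2 (Matrix.of fun i j : Fin 2 => if i.val + j.val + 1 = 2 then (1 : L) else 0) v))).comap (Subtype.val : ↥(fixedBy (((cmDatum L 2 (Matrix.of fun i j : Fin 2 => if i.val + j.val + 1 = 2 then (1 : L) else 0)).Local v) ⧸ (cmLocalIntegralLevel L 2 (Matrix.of fun i j : Fin 2 => if i.val + j.val + 1 = 2 then (1 : L) else 0) v)) δ) → ((cmDatum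 L 2 (Matrix.of fun i j : Fin 2 => if i.val + j.val + 1 = 2 then (1 : L) else 0)).Local v) ⧸ (cmLocalIntegralLevel L 2 (Matrix.of fun i j : Fin 2 => if i.val + j.val + 1 = 2 then (1 : L) else 0) v)))) = 0 :=
      natCard_quotient_fixedBy_eq_zero_of_valuation_apply_ne_one w.1 (((unitaryGroupOfForm (galAdicCompletionMap (L := L) (IsCMField.complexConj L) hw) (placeForm (Matrix.of fun i j : Fin 2 => if i.val + j.val + 1 = 2 then (1 : L) else 0) w.1))).subtype.comp (localNonsplitEquiv (IsCMField.complexConj L) (Matrix.of fun i j : Fin 2 => if i.val + j.val + 1 = 2 then (1 : L) else 0) (IsCMField.complexConj_ne_one L) w hw).toMonoidHom) hδφ hdreg hφ _ hKc h00 _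
    have hzI : Nat.card (Quotient ((orbitRel (Subgroup.zpowers τ) (((cmDatum L 2 (Matrix.of fun i j : Fin 2 => if i.val + j.val + 1 = 2 then (1 : L) else 0)).Local v) ⧸ (((((glInt 2 (w.1.adicCompletion L)).map (MulAut.conj (glDiagonal 2 (w.1.adicCompletion L) ![1, η])).toMonoidHom).comap (((unitaryGroupOfForm (galAdicCompletionMap (L := L) (IsCMField.complexConj L) hw) (placeForm (Matrix.of fun i j : Fin 2 => if i.val + j.val + 1 = 2 then (1 : L) else 0) w.1))).subtype.comp (localNonsplitEquiv (IsCMField.complexConj L) (Matrix.of fun i j : Fin 2 => if i.val + j.val + 1 = 2 then (1 : L) else 0) (IsCMField.complexConj_ne_one L) w hw).toMonoidHom : ((cmDatum L 2 (Matrix.of fun i j : Fin 2 => if i.val + j.val + 1 = 2 then (1 : L) else 0)).Local v) →* GL (Fin 2) (w.1.adicCompletion L))) : Subgroup ((cmDatum L 2 (Matrix.of fun i j : Fin 2 => if i.val + j.val + 1 = 2 then (1 : L) else 0)).Local v)) ⊓ (cmLocalIntegralLevel L 2 (Matrix.of fun i j : Fin 2 => if i.val + j.val + 1 = 2 then (1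 : L) else 0) v)))).comap (Subtype.val : ↥(fixedBy (((cmDatum L 2 (Matrix.of fun i j : Fin 2 => if i.val + j.val + 1 = 2 then (1 : L) else 0)).Local v) ⧸ (((((glInt 2 (w.1.adicCompletion L)).map (MulAut.conj (glDiagonal 2 (w.1.adicCompletion L) ![1, η])).toMonoidHom).comap (((unitaryGroupOfForm (galAdicCompletionMap (L := L) (IsCMField.complexConj L) hw) (placeForm (Matrix.of fun i j : Fin 2 => if i.val + j.val + 1 = 2 then (1 : L) else 0) w.1))).subtype.comp (localNonsplitEquiv (IsCMField.complexConj L) (Matrix.of fun i j : Fin 2 => if i.val + j.val + 1 = 2 then (1 : L) else 0) (IsCMField.complexConj_ne_one L) w hw).toMonoidHom : ((cmDatum L 2 (Matrix.of fun i j : Fin 2 => if i.val + j.val + 1 = 2 then (1 : L) else 0)).Local v) →* GL (Fin 2) (w.1.adicCompletion L))) : Subgroup ((cmDatum L 2 (Matrix.of fun i j : Fin 2 => if i.val + j.val + 1 = 2 then (1 : L) else 0)).Local v)) ⊓ (cmLocalIntegralLevel L 2 (Matrix.of fun i j : Fin 2 => if i.val + j.val + 1 = 2 then (1 : L) else 0)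 v))) δ) → ((cmDatum L 2 (Matrix.of fun i j : Fin 2 => if i.val + j.val + 1 = 2 then (1 : L) else 0)).Local v) ⧸ (((((glInt 2 (w.1.adicCompletion L)).map (MulAut.conj (glDiagonal 2 (w.1.adicCompletion L) ![1, η])).toMonoidHom).comap (((unitaryGroupOfForm (galAdicCompletionMap (L := L) (IsCMField.complexConj L) hw) (placeForm (Matrix.of fun i j : Fin 2 => if i.val + j.val + 1 = 2 then (1 : L) else 0) w.1))).subtype.comp (localNonsplitEquiv (IsCMField.complexConj L) (Matrix.of fun i j : Fin 2 => if i.val + j.val + 1 = 2 then (1 : L) else 0) (IsCMField.complexConj_ne_one L) w hw).toMonoidHom : ((cmDatum L 2 (Matrix.of fun i j : Fin 2 => if i.val + j.val + 1 = 2 then (1 : L) else 0)).Local v) →* GL (Fin 2) (w.1.adicCompletion L))) : Subgroup ((cmDatum L 2 (Matrix.of fun i j : Fin 2 => if i.val + j.val + 1 = 2 then (1 : L) else 0)).Local v)) ⊓ (cmLocalIntegralLevel L 2 (Matrix.of fun i j : Fin 2 => if i.val + j.val + 1 = 2 then (1 : L) else 0) v))))) = 0 :=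
      natCard_quotient_fixedBy_eq_zero_of_valuation_apply_ne_one w.1 (((unitaryGroupOfForm (galAdicCompletionMap (L := L) (IsCMField.complexConj L) hw) (placeForm (Matrix.of fun i j : Fin 2 => if i.val + j.val + 1 = 2 then (1 : L) else 0) w.1))).subtype.comp (localNonsplitEquiv (IsCMField.complexConj L) (Matrix.of fun i j : Fin 2 => if i.val + j.val + 1 = 2 then (1 : L) else 0) (IsCMField.complexConj_ne_one L) w hw).toMonoidHom) hδφ hdreg hφ _ hIc h00 _
    rw [hzS, hzK, hzI]

/-! ## §2 (N) for every regular non-elliptic class: the `hNtame` binder of ★ «EP-RAM-FOLD» -/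

include hw he h2 hη in
/-- **KOTTWITZ'S NON-ELLIPTIC RELATION (N) ON `U(Φ₂)(L⁺_v)` AT A TAMELY RAMIFIED NON-SPLIT PLACE, at the levels `(K♯_η, K, K♯_η ⊓ K)`**, for EVERY regular
`γ` with non-compact centraliser: `(ν K♯)⁻¹Φ(⟦γ⟧,𝟙_{K♯}) + (ν K)⁻¹Φ(⟦γ⟧,𝟙_K) − (ν I)⁻¹Φ(⟦γ⟧,𝟙_I) = 0` — `γ` is conjugate to a class with regular diagonal one-place
image (★ `exists_conj_val_eq_glDiagonal_of_not_compactSpace_centralizer`), where §1 applies.  This is the `hNtame` binder of ★ B-p14 (g32)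
`rankOneEulerPoincareNonsplit_of_tameNonElliptic_of_wildRamified` at the place `(L, v, w)` (the anti-fixedness of `η` offered there is not needed: any uniformiser works).
[cite: Kottwitz1988, §2 Theorem 2] [cite: Serre1980Trees, I.6.4, II.1.3] [cite: Rogawski1990, §12.6 p. 174; §4.9 (4.9.2) p. 55] -/
theorem epNonEllipticRelation_vertexEdgeLevels_of_ramified
    {m : OrbitalMeasureFamily ((cmDatum L 2 (Matrix.of fun i j : Fin 2 => if i.val + j.val + 1 = 2 then (1 : L) else 0)).Local v)}
    (hm : m.IsCanonical (fun γ => IsRegularElt (γ.val : GL (Fin 2) (UnitaryGroup.LocalRing L v))) ν)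
    (γ : ((cmDatum L 2 (Matrix.of fun i j : Fin 2 => if i.val + j.val + 1 = 2 then (1 : L) else 0)).Local v)) (hreg : IsRegularElt (γ.val : GL (Fin 2) (UnitaryGroup.LocalRing L v)))
    (hnc : ¬ CompactSpace (Subgroup.centralizer ({γ} : Set ((cmDatum L 2 (Matrix.of fun i j : Fin 2 => if i.val + j.val + 1 = 2 then (1 : L) else 0)).Local v)))) :
    (((ν ((((glInt 2 (w.1.adicCompletion L)).map (MulAut.conj (glDiagonal 2 (w.1.adicCompletion L) ![1, η])).toMonoidHom).comap (((unitaryGroupOfForm (galAdicCompletionMap (L := L) (IsCMField.complexConj L) hw) (placeForm (Matrix.of fun i j : Fin 2 => if i.val + j.val + 1 = 2 then (1 : L) else 0) w.1))).subtype.comp (localNonsplitEquiv (IsCMField.complexConj L) (Matrix.of fun i j : Fin 2 => if i.val + j.val + 1 = 2 then (1 : L) else 0) (IsCMField.complexConj_ne_one L) w hw).toMonoidHom : ((cmDatum L 2 (Matrix.of fun i j : Fin 2 => if i.val + j.val + 1 = 2 then (1 : L) else 0)).Local v) →* GL (Fin 2) (w.1.adicCompletion L))) : Subgroup ((cmDatum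 L 2 (Matrix.of fun i j : Fin 2 => if i.val + j.val + 1 = 2 then (1 : L) else 0)).Local v))).toReal : ℂ))⁻¹ * classOrbitalIntegral m ((((((glInt 2 (w.1.adicCompletion L)).map (MulAut.conj (glDiagonal 2 (w.1.adicCompletion L) ![1, η])).toMonoidHom).comap (((unitaryGroupOfForm (galAdicCompletionMap (L := L) (IsCMField.complexConj L) hw) (placeForm (Matrix.of fun i j : Fin 2 => if i.val + j.val + 1 = 2 then (1 : L) else 0) w.1))).subtype.comp (localNonsplitEquiv (IsCMField.complexConj L) (Matrix.of fun i j : Fin 2 => if i.val + j.val + 1 = 2 then (1 : L) else 0) (IsCMField.complexConj_ne_one L) w hw).toMonoidHom : ((cmDatum L 2 (Matrix.of fun i j : Fin 2 => if i.val + j.val + 1 = 2 then (1 : L) else 0)).Local v) →* GL (Fin 2) (w.1.adicCompletion L))) : Subgroup ((cmDatum L 2 (Matrix.of fun i j : Fin 2 => if i.val + j.val + 1 = 2 then (1 : L) else 0)).Local v)) : Set ((cmDatum L 2 (Matrix.of fun i j : Fin 2 => if i.val + j.val + 1 = 2 then (1 : L) else 0)).Local v)).indicator fun _ => (1 : ℂ))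 (ConjClasses.mk γ) +
        (((ν (cmLocalIntegralLevel L 2 (Matrix.of fun i j : Fin 2 => if i.val + j.val + 1 = 2 then (1 : L) else 0) v)).toReal : ℂ))⁻¹ * classOrbitalIntegral m (((cmLocalIntegralLevel L 2 (Matrix.of fun i j : Fin 2 => if i.val + j.val + 1 = 2 then (1 : L) else 0) v) : Set ((cmDatum L 2 (Matrix.of fun i j : Fin 2 => if i.val + j.val + 1 = 2 then (1 : L) else 0)).Local v)).indicator fun _ => (1 : ℂ)) (ConjClasses.mk γ) -
        (((ν (((((glInt 2 (w.1.adicCompletion L)).map (MulAut.conj (glDiagonal 2 (w.1.adicCompletion L) ![1, η])).toMonoidHom).comap (((unitaryGroupOfForm (galAdicCompletionMap (L := L) (IsCMField.complexConj L) hw) (placeForm (Matrix.of fun i j : Fin 2 => if i.val + j.val + 1 = 2 then (1 : L) else 0) w.1))).subtype.comp (localNonsplitEquiv (IsCMField.complexConj L) (Matrix.of fun i j : Fin 2 => if i.val + j.val + 1 = 2 then (1 : L) else 0) (IsCMField.complexConj_ne_one L) w hw).toMonoidHom : ((cmDatum L 2 (Matrix.of fun i j : Fin 2 => if i.val + j.val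 + 1 = 2 then (1 : L) else 0)).Local v) →* GL (Fin 2) (w.1.adicCompletion L))) : Subgroup ((cmDatum L 2 (Matrix.of fun i j : Fin 2 => if i.val + j.val + 1 = 2 then (1 : L) else 0)).Local v)) ⊓ (cmLocalIntegralLevel L 2 (Matrix.of fun i j : Fin 2 => if i.val + j.val + 1 = 2 then (1 : L) else 0) v))).toReal : ℂ))⁻¹ * classOrbitalIntegral m (((((((glInt 2 (w.1.adicCompletion L)).map (MulAut.conj (glDiagonal 2 (w.1.adicCompletion L) ![1, η])).toMonoidHom).comap (((unitaryGroupOfForm (galAdicCompletionMap (L := L) (IsCMField.complexConj L) hw) (placeForm (Matrix.of fun i j : Fin 2 => if i.val + j.val + 1 = 2 then (1 : L) else 0) w.1))).subtype.comp (localNonsplitEquiv (IsCMField.complexConj L) (Matrix.of fun i j : Fin 2 => if i.val + j.val + 1 = 2 then (1 : L) else 0) (IsCMField.complexConj_ne_one L) w hw).toMonoidHom : ((cmDatum L 2 (Matrix.of fun i j : Fin 2 => if i.val + j.val + 1 = 2 then (1 : L) else 0)).Local v) →* GL (Fin 2) (w.1.adicCompletion L))) : Subgroup ((cmDatum L 2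 (Matrix.of fun i j : Fin 2 => if i.val + j.val + 1 = 2 then (1 : L) else 0)).Local v)) ⊓ (cmLocalIntegralLevel L 2 (Matrix.of fun i j : Fin 2 => if i.val + j.val + 1 = 2 then (1 : L) else 0) v)) : Set ((cmDatum L 2 (Matrix.of fun i j : Fin 2 => if i.val + j.val + 1 = 2 then (1 : L) else 0)).Local v)).indicator fun _ => (1 : ℂ)) (ConjClasses.mk γ) = 0 := by
  classical
  haveI : Algebra.IsQuadraticExtension ↥(maximalRealSubfield L) L := IsCMField.isQuadraticExtension L
  haveI : Subsingleton (PlacesOver L v) :=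
    PlacesOver.subsingleton_of_smul_eq (IsCMField.complexConj L) (IsCMField.complexConj_ne_one L) w hw
  -- conjugate to a class with regular diagonal one-place image
  obtain ⟨g, dv, hdv, h01, -⟩ := exists_conj_val_eq_glDiagonal_of_not_compactSpace_centralizer L v w hw γ hreg hnc
  have hcl : ConjClasses.mk (g * γ * g⁻¹) = ConjClasses.mk γ := ConjClasses.mk_eq_mk_iff_isConj.2 (isConj_iff.2 ⟨g, rfl⟩).symm
  have hreg' : IsRegularElt ((g * γ * g⁻¹).val : GL (Fin 2) (UnitaryGroup.LocalRing L v)) :=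
    isRegularElt_val_conj L 2 (Matrix.of fun i j : Fin 2 => if i.val + j.val + 1 = 2 then (1 : L) else 0) v γ g hreg
  rw [← hcl]
  -- `e_w (g γ g⁻¹) = diag(d)` with `d i := (dv i)_w`, and `d₀ ≠ d₁`
  have hδ : ((((localNonsplitEquiv (IsCMField.complexConj L) (Matrix.of fun i j : Fin 2 => if i.val + j.val + 1 = 2 then (1 : L) else 0) (IsCMField.complexConj_ne_one L) w hw) (g * γ * g⁻¹) : ↥(unitaryGroupOfForm (galAdicCompletionMap (L := L) (IsCMField.complexConj L) hw) (placeForm (Matrix.of fun i j : Fin 2 => if i.val + j.val + 1 = 2 then (1 : L) else 0) w.1))) : GL (Fin 2) (w.1.adicCompletion L)) : Matrix (Fin 2) (Fin 2) (w.1.adicCompletion L)) =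
      Matrix.diagonal fun i => ((dv i : (UnitaryGroup.LocalRing L v)ˣ) : UnitaryGroup.LocalRing L v) w := by
    have h1 : ((((localNonsplitEquiv (IsCMField.complexConj L) (Matrix.of fun i j : Fin 2 => if i.val + j.val + 1 = 2 then (1 : L) else 0) (IsCMField.complexConj_ne_one L) w hw) (g * γ * g⁻¹) : ↥(unitaryGroupOfForm (galAdicCompletionMap (L := L) (IsCMField.complexConj L) hw) (placeForm (Matrix.of fun i j : Fin 2 => if i.val + j.val + 1 = 2 then (1 : L) else 0) w.1))) : GL (Fin 2) (w.1.adicCompletion L)) : Matrix (Fin 2) (Fin 2) (w.1.adicCompletion L)) =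
        (((g * γ * g⁻¹).val : GL (Fin 2) (UnitaryGroup.LocalRing L v)) : Matrix (Fin 2) (Fin 2) (UnitaryGroup.LocalRing L v)).map
          (Pi.evalRingHom (fun w' : PlacesOver L v => w'.1.adicCompletion L) w) := rfl
    rw [h1, ← hdv, coe_glDiagonal, Matrix.diagonal_map (map_zero _)]
    rfl
  have hd01 : (fun i : Fin 2 => ((dv i : (UnitaryGroup.LocalRing L v)ˣ) : UnitaryGroup.LocalRing L v) w) 0 ≠
      (fun i : Fin 2 => ((dv i : (UnitaryGroup.LocalRing L v)ˣ) : UnitaryGroup.LocalRing L v) w) 1 := by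
    intro h
    apply h01
    apply Units.ext
    funext w'
    obtain rfl : w' = w := Subsingleton.elim w' w
    exact h
  exact epNonEllipticRelation_vertexEdgeLevels_of_diagonal_of_ramified L w hw he h2 η hη ν hm (g * γ * g⁻¹) hreg' hδ hd01

end TameRamified

end Literature.NumberTheory.Rogawski1990

end
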